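import Literature.AlgebraicGeometry.AbelianVarieties.MarkmanKernelTranslate
import Literature.AlgebraicGeometry.Markman2025.SecantQuotientCarrier
import Literature.AlgebraicGeometry.Motives.AbelianVarietyProductIsogeny
import HarnessLib

/-!
# The untwisted product model of Markman's quotient square: `(A × A) × Â ≅ (A × Â) × A` and the CARTESIAN square
# `(g′, π″; q, pr_Y)` over the secant quotient `Y = (A × Â)/Ḡ`

Layer `Literature/AlgebraicGeometry/AbelianVarieties`; sequel to `MarkmanKernelTranslate` (the span leg `g′ = kernelSpanMap`,
`g′ = (ab⁻¹, β·φ_Θ(ab))`) and `Markman2025/SecantQuotientCarrier` (the quotient isogeny `q : P = A × Â → Y = P/Ḡ`).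

* §1 HOMOMORPHISMS (the preadditive category `AbelianVariety ℂ`): `g′ = (a − b, β + φ_Θ(a + b))` as a homomorphism
  (`kernelSpanHom`, underlying morphism `= kernelSpanMap`), the character **`χ := (j+1)·pr_A + j·φ_Θ⁻¹∘pr_Â : P → A`**
  (`untwistChar`), and the UNTWISTING ISOMORPHISM **`Ω = (g′, b + χ(g′)) : (A × A) × Â ⥲ P × A`** (`untwistIso`; explicit inverse
  `((c, γ), b′) ↦ (c + b, b, γ − φ_Θ(c + 2b))`, `b = b′ − χ(c, γ)`; identities by `prod_hom_ext` and additive algebra) — under `Ω`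
  the translation action of `T = G₁ × G₂` becomes `t_{σ(u)} × 1_A` because `χ(σ(x₁, x₂)) = x₂⁻¹` on `Ḡ` (sequel file);
* §2 **`π″ := Ω ≫ (q × 1_A) : (A × A) × Â → Y × A`** (`quotientProductHom`) and THE CARTESIAN SQUARE **`IsPullback g′ π″ q pr_Y`** on
  underlying schemes (`isPullback_kernelSpanMap_quotientProduct`): `(A × A) × Â ≅ P × A ≅ P ×_Y (Y × A)` — pasting of product
  squares (`isPullback_toSchemeHom_fst_prodMap`), no quotient or torsor theory.

The complex points of `Ker (q × 1_A)`, the factorisation `π″ ≫ ε = (π₁ × π₂) × 1_Â` and the transported kernel descent are the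
sequel `MarkmanQuotientSquare`. This is the (K2) step of the cell `pub-hodge-ring2`'s reading of Markman §9.3 (Remark 9.3.7):
with `Z₀ = Y × A`, `g₀ = pr_Y` the flat base change runs on a square that is cartesian BY CONSTRUCTION. Everything PROVED;
0 named facts; no instance, no notation. A research route conditional on HC_CM, not a corollary — nothing here refers to it.

## References

* E. Markman, arXiv:2502.03415 (2025), §1.5 (p. 7: `q`, `Y`), §9.3 Lemma 9.3.3, Remark 9.3.7 (pp. 71–73). [Markman2025SecantWeil]
* D. Mumford, *Abelian Varieties* (1970), §7 Thm. 4 (p. 72), §19 (homomorphisms into products). [MumfordAV1970]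
* R. Hartshorne, *Algebraic Geometry* (1977), III Prop. 9.3 (base change squares). [Hartshorne1977]
-/

noncomputable section

-- `TopCat.Presheaf`/`Scheme.Modules` are not reducible (as in Mathlib's `AlgebraicGeometry/Modules/Sheaf.lean`).
set_option backward.isDefEq.respectTransparency false

open CategoryTheory CategoryTheory.Limits AlgebraicGeometry MonoidalCategory CartesianMonoidalCategory
open AlgebraicGeometry.Scheme.Modules

namespace Literature.AlgebraicGeometry.AbelianVarieties

open Literature.AlgebraicGeometry.Motives Literature.AlgebraicGeometry.Modules Literature.AlgebraicGeometry.Markman2025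
open scoped MonObj

variable (A : AbelianVariety ℂ) {Θ : CartierDivisor A.X.left} (hΘ : Θ.IsAmple)

/-! ### §1 The span leg, the character `χ` and the untwisting isomorphism, as homomorphisms -/

section Homs

/-- **The span leg `g′ = (a − b, β + φ_Θ(a + b)) : (A × A) × Â → A × Â` as a homomorphism** of abelian varieties
(additive notation in the preadditive category; its underlying morphism is `kernelSpanMap`). [cite: Markman2025SecantWeil, §9.3 Lemma 9.3.3 (p. 71 L54–70)] -/
def kernelSpanHom : (A.prod A).prod (A.dualOf Θ hΘ) ⟶ A.prod (A.dualOf Θ hΘ) :=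
  AbelianVariety.prodLift
    (AbelianVariety.fst (A.prod A) (A.dualOf Θ hΘ) ≫ AbelianVariety.fst A A -
      AbelianVariety.fst (A.prod A) (A.dualOf Θ hΘ) ≫ AbelianVariety.snd A A)
    (AbelianVariety.snd (A.prod A) (A.dualOf Θ hΘ) +
      (AbelianVariety.fst (A.prod A) (A.dualOf Θ hΘ) ≫ AbelianVariety.fst A A +
        AbelianVariety.fst (A.prod A) (A.dualOf Θ hΘ) ≫ AbelianVariety.snd A A) ≫ A.phiTheta Θ hΘ)

/-- **The underlying morphism of `kernelSpanHom` is `kernelSpanMap` (`= Ξ ≫ pr₁₃`).** [cite: Markman2025SecantWeil, §9.3 Lemma 9.3.3 (p. 71 L54–70)] -/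
theorem kernelSpanHom_hom : (kernelSpanHom A hΘ).hom.hom.hom = kernelSpanMap A hΘ := by
  apply CartesianMonoidalCategory.hom_ext
  · rw [kernelSpanMap_comp_fst]
    change (kernelSpanHom A hΘ ≫ AbelianVariety.fst A (A.dualOf Θ hΘ)).hom.hom.hom = _
    rw [kernelSpanHom, AbelianVariety.prodLift_fst, sub_eq_add_neg]
    rfl
  · rw [kernelSpanMap_comp_snd]
    change (kernelSpanHom A hΘ ≫ AbelianVariety.snd A (A.dualOf Θ hΘ)).hom.hom.hom = _
    rw [kernelSpanHom, AbelianVariety.prodLift_snd]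
    rfl

variable (hK : A.KTheta Θ = ⊥)

/-- **The character `χ := (j+1)·pr_A + j·(pr_Â ≫ φ_Θ⁻¹) : A × Â → A`** by which the `A`-coordinate `b` is untwisted:
on Markman's group, `χ(σ(x₁, x₂)) = (x₁x₂⁻¹)^{j+1}(x₁x₂)^{j} = x₁ⁿ·x₂⁻¹ = x₂⁻¹` for `x₁ ∈ G₁ ≤ A[n]`, `n = 2j+1`.
[cite: Markman2025SecantWeil, §9.3 Lemma 9.3.3 (p. 71: the subgroup Ḡ and its action)] -/
def untwistChar (j : ℕ) : A.prod (A.dualOf Θ hΘ) ⟶ A :=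
  (j + 1) • AbelianVariety.fst A (A.dualOf Θ hΘ) +
    j • (AbelianVariety.snd A (A.dualOf Θ hΘ) ≫ (A.dualIsoOfPrincipal hΘ hK).inv)

/-- **`Ω := (g′, b + χ(g′)) : (A × A) × Â → (A × Â) × A`.** [cite: Markman2025SecantWeil, §9.3 Lemma 9.3.3 (p. 71)] -/
def untwistHom (j : ℕ) : (A.prod A).prod (A.dualOf Θ hΘ) ⟶ (A.prod (A.dualOf Θ hΘ)).prod A :=
  AbelianVariety.prodLift (kernelSpanHom A hΘ)
    (AbelianVariety.fst (A.prod A) (A.dualOf Θ hΘ) ≫ AbelianVariety.snd A A + kernelSpanHom A hΘ ≫ untwistChar A hΘ hK j)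

/-- **`Ω⁻¹ : ((c, γ), b′) ↦ (c + b, b, γ − φ_Θ(c + 2b))`, `b := b′ − χ(c, γ)`.** [cite: Markman2025SecantWeil, §9.3 Lemma 9.3.3 (p. 71)] -/
def untwistInv (j : ℕ) : (A.prod (A.dualOf Θ hΘ)).prod A ⟶ (A.prod A).prod (A.dualOf Θ hΘ) :=
  AbelianVariety.prodLift
    (AbelianVariety.prodLift
      (AbelianVariety.fst (A.prod (A.dualOf Θ hΘ)) A ≫ AbelianVariety.fst A (A.dualOf Θ hΘ) +
        (AbelianVariety.snd (A.prod (A.dualOf Θ hΘ)) A - AbelianVariety.fst (A.prod (A.dualOf Θ hΘ)) A ≫ untwistChar A hΘ hK j))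
      (AbelianVariety.snd (A.prod (A.dualOf Θ hΘ)) A - AbelianVariety.fst (A.prod (A.dualOf Θ hΘ)) A ≫ untwistChar A hΘ hK j))
    (AbelianVariety.fst (A.prod (A.dualOf Θ hΘ)) A ≫ AbelianVariety.snd A (A.dualOf Θ hΘ) -
      (AbelianVariety.fst (A.prod (A.dualOf Θ hΘ)) A ≫ AbelianVariety.fst A (A.dualOf Θ hΘ) +
        2 • (AbelianVariety.snd (A.prod (A.dualOf Θ hΘ)) A -
          AbelianVariety.fst (A.prod (A.dualOf Θ hΘ)) A ≫ untwistChar A hΘ hK j)) ≫ A.phiTheta Θ hΘ)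

/-- `Ω ≫ pr_P = g′`. [cite: Markman2025SecantWeil, §9.3 Lemma 9.3.3 (p. 71)] -/
@[reassoc]
theorem untwistHom_fst (j : ℕ) :
    untwistHom A hΘ hK j ≫ AbelianVariety.fst (A.prod (A.dualOf Θ hΘ)) A = kernelSpanHom A hΘ :=
  AbelianVariety.prodLift_fst _ _

/-- `Ω ≫ pr_A = b + g′ ≫ χ`. [cite: Markman2025SecantWeil, §9.3 Lemma 9.3.3 (p. 71)] -/
@[reassoc]
theorem untwistHom_snd (j : ℕ) :
    untwistHom A hΘ hK j ≫ AbelianVariety.snd (A.prod (A.dualOf Θ hΘ)) A =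
      AbelianVariety.fst (A.prod A) (A.dualOf Θ hΘ) ≫ AbelianVariety.snd A A + kernelSpanHom A hΘ ≫ untwistChar A hΘ hK j :=
  AbelianVariety.prodLift_snd _ _

/-- `g′ ≫ pr_A = a − b`. [cite: Markman2025SecantWeil, §9.3 Lemma 9.3.3 (p. 71)] -/
@[reassoc]
theorem kernelSpanHom_fst :
    kernelSpanHom A hΘ ≫ AbelianVariety.fst A (A.dualOf Θ hΘ) =
      AbelianVariety.fst (A.prod A) (A.dualOf Θ hΘ) ≫ AbelianVariety.fst A A -
        AbelianVariety.fst (A.prod A) (A.dualOf Θ hΘ) ≫ AbelianVariety.snd A A :=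
  AbelianVariety.prodLift_fst _ _

/-- `g′ ≫ pr_Â = β + (a + b) ≫ φ_Θ`. [cite: Markman2025SecantWeil, §9.3 Lemma 9.3.3 (p. 71)] -/
@[reassoc]
theorem kernelSpanHom_snd :
    kernelSpanHom A hΘ ≫ AbelianVariety.snd A (A.dualOf Θ hΘ) =
      AbelianVariety.snd (A.prod A) (A.dualOf Θ hΘ) +
        (AbelianVariety.fst (A.prod A) (A.dualOf Θ hΘ) ≫ AbelianVariety.fst A A +
          AbelianVariety.fst (A.prod A) (A.dualOf Θ hΘ) ≫ AbelianVariety.snd A A) ≫ A.phiTheta Θ hΘ :=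
  AbelianVariety.prodLift_snd _ _

/-- `Ω ≫ Ω⁻¹ = 𝟙`. [cite: Markman2025SecantWeil, §9.3 Lemma 9.3.3 (p. 71)] -/
theorem untwistHom_comp_untwistInv (j : ℕ) : untwistHom A hΘ hK j ≫ untwistInv A hΘ hK j = 𝟙 _ := by
  have hb : untwistHom A hΘ hK j ≫ (AbelianVariety.snd (A.prod (A.dualOf Θ hΘ)) A -
      AbelianVariety.fst (A.prod (A.dualOf Θ hΘ)) A ≫ untwistChar A hΘ hK j) =
      AbelianVariety.fst (A.prod A) (A.dualOf Θ hΘ) ≫ AbelianVariety.snd A A := by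
    rw [Preadditive.comp_sub, untwistHom_snd, untwistHom_fst_assoc, add_sub_cancel_right]
  refine AbelianVariety.prod_hom_ext (AbelianVariety.prod_hom_ext ?_ ?_) ?_
  · rw [Category.assoc, Category.assoc, Category.id_comp, untwistInv, AbelianVariety.prodLift_fst_assoc, AbelianVariety.prodLift_fst,
      Preadditive.comp_add, hb, untwistHom_fst_assoc, kernelSpanHom_fst, sub_add_cancel]
  · rw [Category.assoc, Category.assoc, Category.id_comp, untwistInv, AbelianVariety.prodLift_fst_assoc, AbelianVariety.prodLift_snd, hb]
  · rw [Category.assoc, Category.id_comp, untwistInv, AbelianVariety.prodLift_snd, Preadditive.comp_sub,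
      ← Category.assoc (untwistHom A hΘ hK j) _ (A.phiTheta Θ hΘ), Preadditive.comp_add, Preadditive.comp_nsmul, hb,
      untwistHom_fst_assoc, untwistHom_fst_assoc, kernelSpanHom_fst, kernelSpanHom_snd,
      show AbelianVariety.fst (A.prod A) (A.dualOf Θ hΘ) ≫ AbelianVariety.fst A A -
          AbelianVariety.fst (A.prod A) (A.dualOf Θ hΘ) ≫ AbelianVariety.snd A A +
          2 • (AbelianVariety.fst (A.prod A) (A.dualOf Θ hΘ) ≫ AbelianVariety.snd A A) =
        AbelianVariety.fst (A.prod A) (A.dualOf Θ hΘ) ≫ AbelianVariety.fst A A +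
          AbelianVariety.fst (A.prod A) (A.dualOf Θ hΘ) ≫ AbelianVariety.snd A A by abel,
      add_sub_cancel_right]

/-- `Ω⁻¹ ≫ g′ = pr_P`. [cite: Markman2025SecantWeil, §9.3 Lemma 9.3.3 (p. 71)] -/
theorem untwistInv_comp_kernelSpanHom (j : ℕ) :
    untwistInv A hΘ hK j ≫ kernelSpanHom A hΘ = AbelianVariety.fst (A.prod (A.dualOf Θ hΘ)) A := by
  refine AbelianVariety.prod_hom_ext ?_ ?_
  · rw [Category.assoc, kernelSpanHom_fst, Preadditive.comp_sub, untwistInv, AbelianVariety.prodLift_fst_assoc,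
      AbelianVariety.prodLift_fst_assoc, AbelianVariety.prodLift_fst, AbelianVariety.prodLift_snd, add_sub_cancel_right]
  · rw [Category.assoc, kernelSpanHom_snd, Preadditive.comp_add,
      ← Category.assoc (untwistInv A hΘ hK j) _ (A.phiTheta Θ hΘ), Preadditive.comp_add, untwistInv,
      AbelianVariety.prodLift_snd, AbelianVariety.prodLift_fst_assoc, AbelianVariety.prodLift_fst_assoc, AbelianVariety.prodLift_fst,
      AbelianVariety.prodLift_snd,
      show AbelianVariety.fst (A.prod (A.dualOf Θ hΘ)) A ≫ AbelianVariety.fst A (A.dualOf Θ hΘ) +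
          (AbelianVariety.snd (A.prod (A.dualOf Θ hΘ)) A - AbelianVariety.fst (A.prod (A.dualOf Θ hΘ)) A ≫ untwistChar A hΘ hK j) +
          (AbelianVariety.snd (A.prod (A.dualOf Θ hΘ)) A - AbelianVariety.fst (A.prod (A.dualOf Θ hΘ)) A ≫ untwistChar A hΘ hK j) =
        AbelianVariety.fst (A.prod (A.dualOf Θ hΘ)) A ≫ AbelianVariety.fst A (A.dualOf Θ hΘ) +
          2 • (AbelianVariety.snd (A.prod (A.dualOf Θ hΘ)) A - AbelianVariety.fst (A.prod (A.dualOf Θ hΘ)) A ≫ untwistChar A hΘ hK j)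
        by abel,
      sub_add_cancel]

/-- `Ω⁻¹ ≫ Ω = 𝟙`. [cite: Markman2025SecantWeil, §9.3 Lemma 9.3.3 (p. 71)] -/
theorem untwistInv_comp_untwistHom (j : ℕ) : untwistInv A hΘ hK j ≫ untwistHom A hΘ hK j = 𝟙 _ := by
  refine AbelianVariety.prod_hom_ext ?_ ?_
  · rw [Category.assoc, untwistHom_fst, untwistInv_comp_kernelSpanHom, Category.id_comp]
  · rw [Category.assoc, untwistHom_snd, Preadditive.comp_add,
      ← Category.assoc (untwistInv A hΘ hK j) (kernelSpanHom A hΘ) (untwistChar A hΘ hK j), untwistInv_comp_kernelSpanHom,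
      Category.id_comp, untwistInv, AbelianVariety.prodLift_fst_assoc, AbelianVariety.prodLift_snd, sub_add_cancel]

/-- **THE UNTWISTING ISOMORPHISM `Ω : (A × A) × Â ≅ (A × Â) × A`** of abelian varieties. [cite: Markman2025SecantWeil, §9.3 Lemma 9.3.3 (p. 71)] -/
def untwistIso (j : ℕ) : (A.prod A).prod (A.dualOf Θ hΘ) ≅ (A.prod (A.dualOf Θ hΘ)).prod A where
  hom := untwistHom A hΘ hK j
  inv := untwistInv A hΘ hK j
  hom_inv_id := untwistHom_comp_untwistInv A hΘ hK j
  inv_hom_id := untwistInv_comp_untwistHom A hΘ hK j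

/-- `Ω` on underlying `ℂ`-schemes. [cite: Markman2025SecantWeil, §9.3 Lemma 9.3.3 (p. 71)] -/
def untwistSchemeIso (j : ℕ) : ((A.X ⊗ A.X) ⊗ (A.dualOf Θ hΘ).X).left ≅ ((A.X ⊗ (A.dualOf Θ hΘ).X) ⊗ A.X).left where
  hom := AbelianVariety.Hom.toSchemeHom (untwistHom A hΘ hK j)
  inv := AbelianVariety.Hom.toSchemeHom (untwistInv A hΘ hK j)
  hom_inv_id := by
    change AbelianVariety.Hom.toSchemeHom (untwistHom A hΘ hK j ≫ untwistInv A hΘ hK j) = _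
    rw [untwistHom_comp_untwistInv]
    rfl
  inv_hom_id := by
    change AbelianVariety.Hom.toSchemeHom (untwistInv A hΘ hK j ≫ untwistHom A hΘ hK j) = _
    rw [untwistInv_comp_untwistHom]
    rfl

end Homs

/-! ### §2 The quotient map `π″ = Ω ≫ (q × 1_A)` and the cartesian square -/

section Square

variable (hK : A.KTheta Θ = ⊥) {n : ℕ} (hn : n ≠ 0) (G₁ G₂ : Subgroup (A.Points ℂ))
  (hG₁ : G₁ ≤ A.torsionPoints ℂ n) (hG₂ : G₂ ≤ A.torsionPoints ℂ n)

/-- **`π″ := Ω ≫ (q × 1_A) : (A × A) × Â → Y × A`**, `Y = (A × Â)/Ḡ` Markman's secant quotient, `q` its quotient isogeny.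
[cite: Markman2025SecantWeil, §1.5 (p. 7: q) and §9.3 Remark 9.3.7 (p. 73)] -/
def quotientProductHom (j : ℕ) :
    (A.prod A).prod (A.dualOf Θ hΘ) ⟶ (secantQuotient A hΘ G₁ G₂ hn hG₁ hG₂).prod A :=
  untwistHom A hΘ hK j ≫ AbelianVariety.prodMap (secantQuotientMap A hΘ G₁ G₂ hn hG₁ hG₂) (𝟙 A)

/-- `π″` is an isogeny (an isomorphism followed by `q × 1_A`). [cite: MumfordAV1970, §7 Thm. 4 (p. 72) and §19] -/
theorem quotientProductHom_eq (j : ℕ) :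
    quotientProductHom A hΘ hK hn G₁ G₂ hG₁ hG₂ j =
      (untwistIso A hΘ hK j).hom ≫ AbelianVariety.prodMap (secantQuotientMap A hΘ G₁ G₂ hn hG₁ hG₂) (𝟙 A) := rfl

omit hΘ in
/-- **A product square is cartesian**: for a homomorphism `f : X → Y` and an abelian variety `B`, the square
`(pr_X : X × B → X, f × 1_B : X × B → Y × B; f, pr_Y : Y × B → Y)` of underlying schemes is a pull-back
(`X × B ≅ X ×_Y (Y × B)`, pasting of the two fibre-product squares over `Spec ℂ`). [cite: Hartshorne1977, III Prop. 9.3 (base change squares)] -/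
theorem isPullback_toSchemeHom_fst_prodMap {X Y : AbelianVariety ℂ} (f : X ⟶ Y) (B : AbelianVariety ℂ) :
    IsPullback (AbelianVariety.Hom.toSchemeHom (AbelianVariety.fst X B))
      (AbelianVariety.Hom.toSchemeHom (AbelianVariety.prodMap f (𝟙 B)))
      (AbelianVariety.Hom.toSchemeHom f) (AbelianVariety.Hom.toSchemeHom (AbelianVariety.fst Y B)) := by
  have hX : IsPullback (pullback.snd X.X.hom B.X.hom) (pullback.fst X.X.hom B.X.hom) B.X.hom X.X.hom :=
    (IsPullback.of_hasPullback _ _).flip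
  have hY : IsPullback (pullback.snd Y.X.hom B.X.hom) (pullback.fst Y.X.hom B.X.hom) B.X.hom Y.X.hom :=
    (IsPullback.of_hasPullback _ _).flip
  have htop : AbelianVariety.Hom.toSchemeHom (AbelianVariety.prodMap f (𝟙 B)) ≫ pullback.snd Y.X.hom B.X.hom =
      pullback.snd X.X.hom B.X.hom := by
    change AbelianVariety.Hom.toSchemeHom (AbelianVariety.prodMap f (𝟙 B) ≫ AbelianVariety.snd Y B) = _
    rw [AbelianVariety.prodMap_snd, Category.comp_id]
    rfl
  have hcomm : AbelianVariety.Hom.toSchemeHom (AbelianVariety.prodMap f (𝟙 B)) ≫ pullback.fst Y.X.hom B.X.hom =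
      pullback.fst X.X.hom B.X.hom ≫ AbelianVariety.Hom.toSchemeHom f := by
    change AbelianVariety.Hom.toSchemeHom (AbelianVariety.prodMap f (𝟙 B) ≫ AbelianVariety.fst Y B) = _
    rw [AbelianVariety.prodMap_fst]
    rfl
  have hbot : AbelianVariety.Hom.toSchemeHom f ≫ Y.X.hom = X.X.hom := Over.w f.hom.hom.hom
  have houter : IsPullback (AbelianVariety.Hom.toSchemeHom (AbelianVariety.prodMap f (𝟙 B)) ≫ pullback.snd Y.X.hom B.X.hom)
      (pullback.fst X.X.hom B.X.hom) B.X.hom (AbelianVariety.Hom.toSchemeHom f ≫ Y.X.hom) := by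
    rw [htop, hbot]
    exact hX
  exact (IsPullback.of_right houter hcomm hY).flip

/-- **THE CARTESIAN SQUARE OF THE UNTWISTED PRODUCT MODEL: `IsPullback g′ π″ q pr_Y`** on underlying schemes —
`(A × A) × Â ≅ (A × Â) × A ≅ (A × Â) ×_Y (Y × A)`. This is the square along which (K4)'s flat base change runs.
[cite: Markman2025SecantWeil, §9.3 Remark 9.3.7 (p. 73)] [cite: Hartshorne1977, III Prop. 9.3] -/
theorem isPullback_kernelSpanMap_quotientProduct (j : ℕ) :
    IsPullback (kernelSpanMap A hΘ).left (AbelianVariety.Hom.toSchemeHom (quotientProductHom A hΘ hK hn G₁ G₂ hG₁ hG₂ j))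
      (AbelianVariety.Hom.toSchemeHom (secantQuotientMap A hΘ G₁ G₂ hn hG₁ hG₂))
      (AbelianVariety.Hom.toSchemeHom (AbelianVariety.fst (secantQuotient A hΘ G₁ G₂ hn hG₁ hG₂) A)) := by
  have h := isPullback_toSchemeHom_fst_prodMap (secantQuotientMap A hΘ G₁ G₂ hn hG₁ hG₂) A
  refine h.of_iso (untwistSchemeIso A hΘ hK j).symm (Iso.refl _) (Iso.refl _) (Iso.refl _) ?_ ?_ (by simp) (by simp)
  · rw [Iso.refl_hom, Category.comp_id, Iso.symm_hom, ← kernelSpanHom_hom]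
    change _ = AbelianVariety.Hom.toSchemeHom (untwistInv A hΘ hK j ≫ kernelSpanHom A hΘ)
    rw [untwistInv_comp_kernelSpanHom]
  · rw [Iso.refl_hom, Category.comp_id, Iso.symm_hom]
    change _ = AbelianVariety.Hom.toSchemeHom (untwistInv A hΘ hK j ≫ quotientProductHom A hΘ hK hn G₁ G₂ hG₁ hG₂ j)
    rw [quotientProductHom, ← Category.assoc, untwistInv_comp_untwistHom, Category.id_comp]

end Square

end Literature.AlgebraicGeometry.AbelianVarieties

end
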